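import Literature.MathematicalPhysics.QuantumFieldTheory.Balaban1983to89.T4ShellMeasure
import Summits.QuantumFields.BalabanUV.T4Continuum.Support.ShellMeasureSuperposition
import Summits.QuantumFields.BalabanUV.T4Continuum.Support.ShellMeasureWilsonLedgerSource
import Mathlib.Probability.Moments.Variance

/-!
# N21 (NE7c) · KERNEL-BORNE anti-concentration (lens Card 49: smeared averaging kernel) and the L¹-variation engine (Card 50)

R134 seat pub-ymgap-dag-n21-d (g7), node N21 = NE7c (single-run shell-weight bound, NOT PRINTED in [Bałaban 1983–89],
NOT proved), lane K3⁶ `SpineGivenEndpointR13SepCoPR` (stmt-QuantumFields-20509, `--kind proof --supports … --as helper`).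

THIS FILE = LENS ROW W of `ym-lens-BalabanUVNodes-nearmiss/LENS-nearmiss.md` v17.0 (OPTIONAL, low priority; first
refusal dag-n21-d as the author of the Gaussian comparison series G1–G4): the §S + §V sections of the lens's
`Sketch-nearmiss-g17.lean` (sha16 cfc30ba211cd846d, farm rc 0 · 0 warnings at the lens desk) VERBATIM — statements and
proofs — re-homed in this namespace with this credit header; AUTHORSHIP OF THE MATHEMATICS: planner seat
`ym-lens-BalabanUVNodes-nearmiss` g17 (memo-only seat, cannot file); this seat only files.
§S (Card 49): if the level-`j` averaging kernel has a bondwise density (a smeared kernel IN PLACE OF print's `δ(V·Ū⁻¹)`,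
[B12] (0.16)∕(2.1) — a DESIGN alternative, not the scheme of record), the slot law is a positive translation-mixture of
ONE law with a density bound, and such mixtures inherit (M1) with the SAME constant uniformly in centres and weights
(`slotAntiConcentration_sum_translates`, identity ∕ two-sided ∕ transversal readings; the Gaussian instance
`slotAntiConcentration_sum_gaussianReal` is the «arbitrary means, one variance, any positive mixture» sibling of this
seat's `…GaussianSupDensityBoundHetero`).  §V (Card 50): member (τ)'s translate engine with the POINTWISE forward
comparison replaced by an L¹ forward-VARIATION budget (`card_mul_setLIntegral_le_add_variation`,
`withDensity_le_fraction_of_variation`) and the Cauchy–Schwarz half of the second-order Ward pricing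
(`sq_integral_abs_le_integral_sq_of_memLp`; bounded form already in the tree: `NE7LawLevelOldLayers.sq_integral_abs_le_integral_sq`).

HONEST FRAMING.  [folklore] measure theory ∕ real analysis over the tree's typed (M1) frame (cited by name); every located
input stays a HYPOTHESIS; the smeared kernel is a design alternative whose upstream cost is unpaid (lens KT-49); 0 def,
0 sorry; nothing of Bałaban's asserted.  NE7c NOT PRINTED ∕ NOT proved; N21 NOT discharged; counts unmoved (typed 28∕28 ·
discharged 5∕27); count-neutral; one finite 𝕋⁴ at fixed ε — nothing about ℝ⁴ ∕ OS ∕ mass gap ∕ Clay.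
-/

set_option autoImplicit false

open MeasureTheory Set Finset
open scoped ENNReal NNReal
open Literature.MathematicalPhysics.QuantumFieldTheory.Balaban1983to89
open T4ShellMeasure (SlotAntiConcentration DensityBound)
open Summit.QuantumFields.BalabanUV.T4Continuum.ShellMeasureSuperposition (slotAntiConcentration_sum)
open Summit.QuantumFields.BalabanUV.T4Continuum.ShellMeasureWilsonLedgerSource (slotAntiConcentration_smul)

namespace Summit.QuantumFields.YangMills.Theorems.N21KernelBorneAntiConcentration

/-! ## §S  Card 49 — a smeared kernel makes (M1) kernel-borne: translation-mixtures of a law with a density bound -/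

section Smear

/-- **S1.** A uniform density bound on `ℝ` is invariant under translation of the law (interval lengths are). [folklore] -/
theorem densityBound_map_add_const {ν : Measure ℝ} {P : ℝ} (h : DensityBound ν P) (w : ℝ) :
    DensityBound (ν.map fun x => x + w) P := by
  intro a b hab
  rw [Measure.map_apply (measurable_add_const w) measurableSet_Icc, Set.preimage_add_const_Icc]
  have h' := h (a - w) (b - w) (by linarith)
  have e : b - w - (a - w) = b - a := by ring
  rwa [e] at h'

/-- **S2.** The identity reading: a probability law on `ℝ` with density bound `P` is `(θ, ρ, P·θ)`-anti-concentrated along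
`x ↦ x` — the shell `[θ(1−ρ), θ)` is an interval of length `θρ`. [folklore] -/
theorem slotAntiConcentration_self_of_densityBound {ν : Measure ℝ} [IsProbabilityMeasure ν] {P θ ρ : ℝ}
    (h : DensityBound ν P) (hθ : 0 ≤ θ) (hρ : 0 ≤ ρ) :
    SlotAntiConcentration ν (fun x => x) θ ρ (P * θ) := by
  unfold SlotAntiConcentration
  have hle : θ * (1 - ρ) ≤ θ := by nlinarith
  have hsub : {x : ℝ | θ * (1 - ρ) ≤ x ∧ x < θ} ⊆ Set.Icc (θ * (1 - ρ)) θ := fun x hx => ⟨hx.1, hx.2.le⟩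
  have e : P * (θ - θ * (1 - ρ)) = P * θ * ρ := by ring
  calc ν {x : ℝ | θ * (1 - ρ) ≤ x ∧ x < θ}
      ≤ ν (Set.Icc (θ * (1 - ρ)) θ) := measure_mono hsub
    _ ≤ ENNReal.ofReal (P * (θ - θ * (1 - ρ))) := h _ _ hle
    _ = ENNReal.ofReal (P * θ * ρ) * ν univ := by rw [measure_univ, mul_one, e]

/-- **S2′.** The two-sided (absolute-value) reading costs a factor `2`, not a net: the shell of `|x|` is two intervals of
length `θρ`. (Abelian ∕ scalar small-field letters `|F| < ε` are of this polyhedral type.) [folklore] -/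
theorem slotAntiConcentration_abs_of_densityBound {ν : Measure ℝ} [IsProbabilityMeasure ν] {P θ ρ : ℝ}
    (h : DensityBound ν P) (hP : 0 ≤ P) (hθ : 0 ≤ θ) (hρ : 0 ≤ ρ) :
    SlotAntiConcentration ν (fun x => |x|) θ ρ (2 * P * θ) := by
  unfold SlotAntiConcentration
  have hle : θ * (1 - ρ) ≤ θ := by nlinarith
  have hθρ : 0 ≤ P * θ * ρ := by positivity
  have hsub : {x : ℝ | θ * (1 - ρ) ≤ |x| ∧ |x| < θ}
      ⊆ Set.Icc (θ * (1 - ρ)) θ ∪ Set.Icc (-θ) (-(θ * (1 - ρ))) := by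
    intro x hx
    simp only [Set.mem_setOf_eq] at hx
    rcases le_or_gt 0 x with h0 | h0
    · left
      rw [abs_of_nonneg h0] at hx
      exact ⟨hx.1, hx.2.le⟩
    · right
      rw [abs_of_neg h0] at hx
      exact ⟨by linarith [hx.2], by linarith [hx.1]⟩
  have e1 : P * (θ - θ * (1 - ρ)) = P * θ * ρ := by ring
  have e2 : P * (-(θ * (1 - ρ)) - -θ) = P * θ * ρ := by ring
  calc ν {x : ℝ | θ * (1 - ρ) ≤ |x| ∧ |x| < θ}
      ≤ ν (Set.Icc (θ * (1 - ρ)) θ ∪ Set.Icc (-θ) (-(θ * (1 - ρ)))) := measure_mono hsub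
    _ ≤ ν (Set.Icc (θ * (1 - ρ)) θ) + ν (Set.Icc (-θ) (-(θ * (1 - ρ)))) := measure_union_le _ _
    _ ≤ ENNReal.ofReal (P * (θ - θ * (1 - ρ))) + ENNReal.ofReal (P * (-(θ * (1 - ρ)) - -θ)) :=
        add_le_add (h _ _ hle) (h _ _ (by linarith))
    _ = ENNReal.ofReal (2 * P * θ * ρ) * ν univ := by
        rw [measure_univ, mul_one, e1, e2, ← ENNReal.ofReal_add hθρ hθρ]
        congr 1
        ring

/-- **S2″.** A transversal reading (slope `≥ κ > 0` along the smeared coordinate; device (b) of the tree,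
`T4ShellMeasure.measure_preimage_window_le`): constant `2Pθ/κ`. [folklore] -/
theorem slotAntiConcentration_reading_of_densityBound {ν : Measure ℝ} [IsProbabilityMeasure ν] {P θ ρ κ : ℝ}
    (h : DensityBound ν P) (hκ : 0 < κ) {φ : ℝ → ℝ} (hslope : ∀ x y, x ≤ y → κ * (y - x) ≤ φ y - φ x) :
    SlotAntiConcentration ν φ θ ρ (2 * P * θ / κ) := by
  unfold SlotAntiConcentration
  have hset : {x : ℝ | θ * (1 - ρ) ≤ φ x ∧ φ x < θ} = φ ⁻¹' Set.Ico (θ * (1 - ρ)) (θ * (1 - ρ) + θ * ρ) := by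
    ext x
    simp only [Set.mem_setOf_eq, Set.mem_preimage, Set.mem_Ico]
    constructor
    · rintro ⟨h1, h2⟩; exact ⟨h1, by linarith⟩
    · rintro ⟨h1, h2⟩; exact ⟨h1, by linarith⟩
  have e : P * (2 * (θ * ρ) / κ) = 2 * P * θ / κ * ρ := by ring
  rw [hset, measure_univ, mul_one, ← e]
  exact T4ShellMeasure.measure_preimage_window_le h hκ hslope _ _

/-- **S3 — TRANSLATION-MIXTURES INHERIT (M1), UNIFORMLY IN THE CENTRES.**  A countable positive mixture
`Σ_i c_i • (ν translated by w_i)` of ONE probability law `ν` with density bound `P` — the shape of a bondwise Gaussian ∕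
heat-kernel smear `p_σ ⋆ F` of ANY positive `F` (centres `w_i` = the support of `F`, weights `c_i` = its masses) — is
`(θ, ρ, P·θ)`-anti-concentrated along the identity reading, whatever `w`, `c`.  No property of `F` is consumed.
[folklore] -/
theorem slotAntiConcentration_sum_translates {ι : Type*} [Countable ι] (ν : Measure ℝ) [IsProbabilityMeasure ν]
    {P θ ρ : ℝ} (h : DensityBound ν P) (hθ : 0 ≤ θ) (hρ : 0 ≤ ρ) (w : ι → ℝ) (c : ι → ℝ≥0∞) :
    SlotAntiConcentration (Measure.sum fun i => c i • ν.map fun x => x + w i) (fun x => x) θ ρ (P * θ) := by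
  refine slotAntiConcentration_sum _ fun i => ?_
  refine slotAntiConcentration_smul ?_ (c i)
  haveI : IsProbabilityMeasure (ν.map fun x => x + w i) :=
    Measure.isProbabilityMeasure_map (measurable_add_const (w i)).aemeasurable
  exact slotAntiConcentration_self_of_densityBound (densityBound_map_add_const h (w i)) hθ hρ

/-- **S3′.** The same for the two-sided reading `|x|` (constant `2Pθ`). [folklore] -/
theorem slotAntiConcentration_abs_sum_translates {ι : Type*} [Countable ι] (ν : Measure ℝ) [IsProbabilityMeasure ν]
    {P θ ρ : ℝ} (h : DensityBound ν P) (hP : 0 ≤ P) (hθ : 0 ≤ θ) (hρ : 0 ≤ ρ) (w : ι → ℝ) (c : ι → ℝ≥0∞) :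
    SlotAntiConcentration (Measure.sum fun i => c i • ν.map fun x => x + w i) (fun x => |x|) θ ρ (2 * P * θ) := by
  refine slotAntiConcentration_sum _ fun i => ?_
  refine slotAntiConcentration_smul ?_ (c i)
  haveI : IsProbabilityMeasure (ν.map fun x => x + w i) :=
    Measure.isProbabilityMeasure_map (measurable_add_const (w i)).aemeasurable
  exact slotAntiConcentration_abs_of_densityBound (densityBound_map_add_const h (w i)) hP hθ hρ

/-- **S4 — THE GAUSSIAN INSTANCE** (Bałaban's scalar `δ_H`, [BIJ85] (3.6); the tree's `densityBound_gaussianReal`): a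
countable positive mixture of Gaussians of ONE variance `v ≠ 0` and ARBITRARY means is `(θ, ρ, θ/√(2πv))`-anti-concentrated
along the identity reading. [folklore] -/
theorem slotAntiConcentration_sum_gaussianReal {ι : Type*} [Countable ι] {v : ℝ≥0} (hv : v ≠ 0) {θ ρ : ℝ}
    (hθ : 0 ≤ θ) (hρ : 0 ≤ ρ) (m : ι → ℝ) (c : ι → ℝ≥0∞) :
    SlotAntiConcentration (Measure.sum fun i => c i • ProbabilityTheory.gaussianReal (m i) v) (fun x => x) θ ρ
      ((Real.sqrt (2 * Real.pi * v))⁻¹ * θ) := by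
  refine slotAntiConcentration_sum _ fun i => slotAntiConcentration_smul ?_ (c i)
  exact slotAntiConcentration_self_of_densityBound (T4ShellMeasure.densityBound_gaussianReal (m i) hv) hθ hρ

end Smear

/-! ## §V  Card 50 — member (τ) priced by an L¹ forward-variation budget (then by the second-order Ward identity) -/

section Variation

variable {Ω ι : Type*} [MeasurableSpace Ω] [Fintype ι]

/-- **V1 — SPARSE TRANSLATES WITH AN L¹ VARIATION TERM.**  `e i` measure-preserving automorphisms of `(Ω, μ₀)`, `f` a
measurable density, `S` a measurable piece reached from any point by at most `N` translates.  Then, with NO pointwise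
comparison hypothesis, `|ι|·∫_S f ≤ N·∫ f + Σ_i ∫_S (f − f∘e_i)` (truncated subtraction): the pointwise forward rate of
`ShellMeasureTranslate.card_mul_setLIntegral_le` is replaced by the total FORWARD VARIATION of `f` along the translates
on the piece. [folklore] -/
theorem card_mul_setLIntegral_le_add_variation (μ₀ : Measure Ω) (e : ι → Ω ≃ᵐ Ω)
    (he : ∀ i, MeasurePreserving (e i) μ₀ μ₀) {f : Ω → ℝ≥0∞} (hf : Measurable f) {S : Set Ω}
    (hS : MeasurableSet S) (N : ℕ)
    (hsparse : ∀ y, ∑ i, ((e i).symm ⁻¹' S).indicator (fun _ => (1 : ℝ≥0∞)) y ≤ N) :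
    (Fintype.card ι : ℝ≥0∞) * ∫⁻ x in S, f x ∂μ₀
      ≤ N * ∫⁻ x, f x ∂μ₀ + ∑ i, ∫⁻ x in S, (f x - f (e i x)) ∂μ₀ := by
  have h1 : (Fintype.card ι : ℝ≥0∞) * ∫⁻ x in S, f x ∂μ₀ = ∑ _i : ι, ∫⁻ x in S, f x ∂μ₀ := by
    rw [sum_const, nsmul_eq_mul, Finset.card_univ]
  have h2 : ∀ i, ∫⁻ x in S, f x ∂μ₀
      ≤ ∫⁻ y, ((e i).symm ⁻¹' S).indicator f y ∂μ₀ + ∫⁻ x in S, (f x - f (e i x)) ∂μ₀ := by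
    intro i
    have hfe : Measurable fun x => f (e i x) := hf.comp (e i).measurable
    have hpt : ∀ x, S.indicator (fun x => f (e i x)) x = ((e i).symm ⁻¹' S).indicator f (e i x) := by
      intro x
      by_cases hx : x ∈ S
      · have hx' : e i x ∈ (e i).symm ⁻¹' S := by
          show (e i).symm (e i x) ∈ S
          simpa using hx
        rw [indicator_of_mem hx, indicator_of_mem hx']
      · have hx' : e i x ∉ (e i).symm ⁻¹' S := by
          show ¬ ((e i).symm (e i x) ∈ S)
          simpa using hx
        rw [indicator_of_notMem hx, indicator_of_notMem hx']
    calc ∫⁻ x in S, f x ∂μ₀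
        ≤ ∫⁻ x in S, (f (e i x) + (f x - f (e i x))) ∂μ₀ := lintegral_mono fun x => le_add_tsub
      _ = ∫⁻ x in S, f (e i x) ∂μ₀ + ∫⁻ x in S, (f x - f (e i x)) ∂μ₀ := lintegral_add_left hfe _
      _ = ∫⁻ y, ((e i).symm ⁻¹' S).indicator f y ∂μ₀ + ∫⁻ x in S, (f x - f (e i x)) ∂μ₀ := by
          congr 1
          rw [← lintegral_indicator hS, show (S.indicator fun x => f (e i x)) =
            fun x => ((e i).symm ⁻¹' S).indicator f (e i x) from funext hpt]
          exact (he i).lintegral_comp_emb (e i).measurableEmbedding _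
  have hmeas : ∀ i ∈ (univ : Finset ι), Measurable fun y => ((e i).symm ⁻¹' S).indicator f y :=
    fun i _ => hf.indicator (hS.preimage (e i).symm.measurable)
  calc (Fintype.card ι : ℝ≥0∞) * ∫⁻ x in S, f x ∂μ₀
      = ∑ _i : ι, ∫⁻ x in S, f x ∂μ₀ := h1
    _ ≤ ∑ i : ι, (∫⁻ y, ((e i).symm ⁻¹' S).indicator f y ∂μ₀ + ∫⁻ x in S, (f x - f (e i x)) ∂μ₀) :=
        sum_le_sum fun i _ => h2 i
    _ = (∫⁻ y, ∑ i : ι, ((e i).symm ⁻¹' S).indicator f y ∂μ₀) + ∑ i, ∫⁻ x in S, (f x - f (e i x)) ∂μ₀ := by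
        rw [sum_add_distrib, lintegral_finsetSum _ hmeas]
    _ = (∫⁻ y, (∑ i : ι, ((e i).symm ⁻¹' S).indicator (fun _ => (1 : ℝ≥0∞)) y) * f y ∂μ₀)
          + ∑ i, ∫⁻ x in S, (f x - f (e i x)) ∂μ₀ := by
        congr 1
        refine lintegral_congr fun y => ?_
        rw [sum_mul]
        exact sum_congr rfl fun i _ =>
          Summit.QuantumFields.BalabanUV.T4Continuum.ShellMeasureTranslate.indicator_preimage_eq_mul _ f y
    _ ≤ (∫⁻ y, (N : ℝ≥0∞) * f y ∂μ₀) + ∑ i, ∫⁻ x in S, (f x - f (e i x)) ∂μ₀ := by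
        gcongr with y
        exact hsparse y
    _ = N * ∫⁻ x, f x ∂μ₀ + ∑ i, ∫⁻ x in S, (f x - f (e i x)) ∂μ₀ := by
        rw [lintegral_const_mul'' _ hf.aemeasurable]

/-- **V2 — (M1)-SHAPED FRACTION FROM A RELATIVE VARIATION BUDGET.**  If the total forward variation along the translates on
the piece is at most `b ×` the total mass, then `(f dμ₀)(S) ≤ ((N + b)/|ι|)·(f dμ₀)(univ)` — member (τ)'s
`withDensity_le_fraction` with `C·N` replaced by `N + b`. [folklore] -/
theorem withDensity_le_fraction_of_variation (μ₀ : Measure Ω) (e : ι → Ω ≃ᵐ Ω)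
    (he : ∀ i, MeasurePreserving (e i) μ₀ μ₀) {f : Ω → ℝ≥0∞} (hf : Measurable f) {S : Set Ω}
    (hS : MeasurableSet S) (N : ℕ) {b : ℝ} (hb : 0 ≤ b) (hι : 0 < Fintype.card ι)
    (hsparse : ∀ y, ∑ i, ((e i).symm ⁻¹' S).indicator (fun _ => (1 : ℝ≥0∞)) y ≤ N)
    (hvar : ∑ i, ∫⁻ x in S, (f x - f (e i x)) ∂μ₀ ≤ ENNReal.ofReal b * ∫⁻ x, f x ∂μ₀) :
    μ₀.withDensity f S ≤ ENNReal.ofReal ((N + b) / Fintype.card ι) * μ₀.withDensity f univ := by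
  have hmain := card_mul_setLIntegral_le_add_variation μ₀ e he hf hS N hsparse
  rw [withDensity_apply _ hS, withDensity_apply _ MeasurableSet.univ, Measure.restrict_univ]
  have hk0 : (Fintype.card ι : ℝ≥0∞) ≠ 0 := by exact_mod_cast hι.ne'
  have hktop : (Fintype.card ι : ℝ≥0∞) ≠ ∞ := ENNReal.natCast_ne_top _
  have hNb : (N : ℝ≥0∞) + ENNReal.ofReal b = ENNReal.ofReal (N + b) := by
    rw [ENNReal.ofReal_add (Nat.cast_nonneg _) hb, ENNReal.ofReal_natCast]
  rw [← ENNReal.mul_le_mul_iff_right hk0 hktop]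
  calc (Fintype.card ι : ℝ≥0∞) * ∫⁻ x in S, f x ∂μ₀
      ≤ N * ∫⁻ x, f x ∂μ₀ + ENNReal.ofReal b * ∫⁻ x, f x ∂μ₀ := hmain.trans (add_le_add le_rfl hvar)
    _ = ENNReal.ofReal (N + b) * ∫⁻ x, f x ∂μ₀ := by rw [← add_mul, hNb]
    _ = (Fintype.card ι : ℝ≥0∞) * (ENNReal.ofReal ((N + b) / Fintype.card ι) * ∫⁻ x, f x ∂μ₀) := by
        rw [← mul_assoc]
        congr 1
        rw [← ENNReal.ofReal_natCast (Fintype.card ι), ← ENNReal.ofReal_mul (Nat.cast_nonneg _)]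
        congr 1
        have hk : (0 : ℝ) < Fintype.card ι := by exact_mod_cast hι
        field_simp

/-- **V3 — THE CAUCHY–SCHWARZ HALF OF THE WARD PRICING.**  On a probability space `(E|F|)² ≤ E F²`; with `F = X log f` and the
(untyped) second-order Ward identity `E_f[(X log f)²] = E_f[−X² log f]` for a Haar-invariant one-bond flow `X`, the L¹
log-derivative that bounds V1's variation term is priced by the MEAN STIFFNESS `E_f[−X² log f]`.  `L²` form (via
`ProbabilityTheory.variance_eq_sub`) of the tree's BOUNDED version
`NE7LawLevelOldLayers.sq_integral_abs_le_integral_sq` (hypothesis `|S| ≤ B`); a filer may prefer to cite that one. [folklore] -/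
theorem sq_integral_abs_le_integral_sq_of_memLp {Ω' : Type*} [MeasurableSpace Ω'] (μ : Measure Ω') [IsProbabilityMeasure μ]
    {F : Ω' → ℝ} (hF : MemLp F 2 μ) : (∫ x, |F x| ∂μ) ^ 2 ≤ ∫ x, F x ^ 2 ∂μ := by
  have hA : MemLp (fun x => |F x|) 2 μ := hF.abs
  have hv := ProbabilityTheory.variance_nonneg (fun x => |F x|) μ
  rw [ProbabilityTheory.variance_eq_sub hA] at hv
  have hsq : ∫ x, ((fun x => |F x|) ^ 2) x ∂μ = ∫ x, F x ^ 2 ∂μ := by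
    refine integral_congr_ae (Filter.Eventually.of_forall fun x => ?_)
    simp [sq_abs]
  rw [hsq] at hv
  linarith

end Variation

end Summit.QuantumFields.YangMills.Theorems.N21KernelBorneAntiConcentration
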